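import Summits.Ventures.DiscreteObjects.Verify.DesignsKernel

/-!
# F-INV2 (+) control in the kernel: the plane REBUILT from the GF(2) lift of the STD₂[4;2] quotient of PG(2,4) is a projective plane
Framing: lottery ticket; floor = certified bounds/negative ranges.

Cell pub-namedobj, target M, family F-INV2 (FAMILY-INV2.md; RULING M4; controls signed by verify-ref 2026-08-20T16:14Z). The 21
lines below are the OUTPUT of the lifting pipeline `code/std4/stdlib.py` (elation quotient of PG(2,4) ↦ STD₂[4;2] ↦ GF(2) lift
system ↦ one solution ↦ affine plane ↦ projective completion), i.e. the end-to-end positive control of family F-INV2; `decide`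
re-checks the projective-plane axioms with the cell's kernel verifier `isProjectivePlane` (Verify/DesignsKernel, p203992). This is a
kernel third check of the (+) control (E1 designs g4, E2 verify-ref, lead third engine all rebuilt planes of orders 4/8/16); the
order-8/16 outputs are omitted (size). A consistent lift of an STD₂[12;6], if one is ever found, would be certified the same way.
-/

namespace Summit.Ventures.DiscreteObjects.Verify

/-- the 21 lines (on points 0..20) of the structure rebuilt from the Z₂-lift of the STD₂[4;2] quotient of PG(2,4) by an involutory
elation (output of code/std4, family F-INV2 positive control) -/
def finv2LiftPG4Lines : List (List Nat) :=
  [[0, 4, 8, 12, 16], [1, 5, 9, 13, 16], [2, 6, 10, 14, 16], [3, 7, 11, 15, 16], [0, 6, 11, 13, 17], [1, 7, 10, 12, 17], [2, 4, 9, 15, 17], [3, 5, 8, 14, 17], [2, 5, 11, 12, 18], [3, 4, 10, 13, 18], [0, 7, 9, 14, 18], [1, 6, 8, 15, 18], [2, 7, 8, 13, 19], [3, 6, 9, 12, 19], [0, 5, 10, 15, 19], [1, 4, 11, 14, 19], [0, 1, 2, 3, 20], [4, 5, 6, 7, 20], [8, 9, 10, 11, 20], [12, 13, 14, 15, 20],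 [16, 17, 18, 19, 20]]

/-- **(+) control of family F-INV2, kernel:** the rebuilt structure is a projective plane of order 4. -/
theorem finv2_lift_pg4_isProjectivePlane : isProjectivePlane 4 finv2LiftPG4Lines = true := by decide

end Summit.Ventures.DiscreteObjects.Verify
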